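import Mathlib
import Summits.AnomalousDissipation.AnomalousDissipation.Theorems.DyadicWallCascadeHalfSpaceHierarchyFluxQuadruplesPerOctave

/-!
# Half-scale trace (tool stub of line `bernoulli-surface-topology`,
# crux `DyadicWallCascade.HalfSpaceHierarchy`, item stmt-AnomalousDissipation-18627)

Sorry-free discharge of the registered tool stub `stub_halfScaleTrace` of the lead's skeleton
`Cruxes/HalfSpaceHierarchy/Lines/bernoulli_surface_topology.lean`.

**Statement.**  Let `g : ℝ³ → ℝ` be continuous and `1`-periodic in `x` (coordinate `0`) and in `y`
(coordinate `1`).  Then the integral over the unit square of its half-scale bottom trace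
`q ↦ g (2 • (q₁, q₂, 1)) = g (2q₁, 2q₂, 2)` equals its integral over the unit square at height `2`:
`∫_{[0,1]²} g (2 • (q₁, q₂, 1)) dq = ∫_{[0,1]²} g (q₁, q₂, 2) dq`.

**Proof.**  Put `h p := g (p₁, p₂, 2)` on `ℝ × ℝ`; then `g (2 • (q₁, q₂, 1)) = h (2 • q)`.
(i) Planar change of variables `q ↦ 2 • q` (Lebesgue measure on `ℝ × ℝ` is an additive Haar measure of
`finrank 2`, `Measure.setIntegral_comp_smul_of_pos`): `∫_{[0,1]²} h (2 • q) = 4⁻¹ ∫_{[0,2]²} h`, since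
`2 • ([0,1] ×ˢ [0,1]) = [0,2] ×ˢ [0,2]`.
(ii) Four period cells: `h` is continuous and `1`-periodic in each variable, so writing the set
integral over a rectangle as an iterated interval integral (Fubini, `setIntegral_prod`) and using
`∫₀² f = ∫₀¹ f + ∫₁² f = 2 ∫₀¹ f` for a continuous `1`-periodic `f : ℝ → ℝ`
(`Function.Periodic.intervalIntegral_add_eq`) first in `y` and then in `x` (the inner integral
`x ↦ ∫₀¹ h (x, y) dy` is continuous, `intervalIntegral.continuous_parametric_intervalIntegral_of_continuous'`,
and `1`-periodic) gives `∫_{[0,2]²} h = 4 ∫_{[0,1]²} h`.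

Source: folklore (planar change of variables and periodicity).  Tree import: the landed sibling file
`DyadicWallCascadeHalfSpaceHierarchyFluxQuadruplesPerOctave` (same namespace, same technique).
-/

-- all landed stubs of this crux share the namespace `…Theorems.HalfSpaceHierarchy` across files
set_option linter.dupNamespace false

noncomputable section

open scoped Pointwise
open MeasureTheory

namespace Summit.AnomalousDissipation.AnomalousDissipation.Theorems.HalfSpaceHierarchy

/-- The unit square, doubled, is the square of side `2`:
`2 • ([0,1] ×ˢ [0,1]) = [0,2] ×ˢ [0,2]` (pointwise scalar action on `ℝ × ℝ`). [folklore] -/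
theorem halfScaleTrace_two_smul_unitSquare :
    (2 : ℝ) • (Set.Icc (0 : ℝ) 1 ×ˢ Set.Icc (0 : ℝ) 1) = Set.Icc (0 : ℝ) 2 ×ˢ Set.Icc (0 : ℝ) 2 := by
  have h2 : (0 : ℝ) < 2 := by norm_num
  rw [Set.smul_set_prod, LinearOrderedField.smul_Icc h2, mul_zero, mul_one]

/-- Planar change of variables `q ↦ 2 • q` on the unit square: for EVERY `h : ℝ × ℝ → ℝ`,
`∫_{[0,1]²} h (2 • q) dq = 4⁻¹ ∫_{[0,2]²} h` (Lebesgue measure on `ℝ × ℝ` is an additive Haar measure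
and `finrank ℝ (ℝ × ℝ) = 2`). [folklore] -/
theorem halfScaleTrace_setIntegral_unitSquare_comp_two_smul (h : ℝ × ℝ → ℝ) :
    (∫ q in Set.Icc (0 : ℝ) 1 ×ˢ Set.Icc (0 : ℝ) 1, h ((2 : ℝ) • q)) =
      4⁻¹ * ∫ q in Set.Icc (0 : ℝ) 2 ×ˢ Set.Icc (0 : ℝ) 2, h q := by
  have h2 : (0 : ℝ) < 2 := by norm_num
  rw [Measure.setIntegral_comp_smul_of_pos volume h _ h2, halfScaleTrace_two_smul_unitSquare,
    Module.finrank_prod, Module.finrank_self, smul_eq_mul]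
  norm_num

/-- Fubini on a rectangle for a continuous integrand: the set integral of a continuous
`h : ℝ × ℝ → ℝ` over `[a,b] ×ˢ [c,d]` (`a ≤ b`, `c ≤ d`) is the iterated interval integral
`∫ₐᵇ ∫_c^d h (x, y) dy dx`. [folklore] -/
theorem halfScaleTrace_setIntegral_rect_eq_iterated (h : ℝ × ℝ → ℝ) (hh : Continuous h)
    {a b c d : ℝ} (hab : a ≤ b) (hcd : c ≤ d) :
    (∫ q in Set.Icc a b ×ˢ Set.Icc c d, h q) = ∫ x in a..b, ∫ y in c..d, h (x, y) := by
  have hint : IntegrableOn h (Set.Icc a b ×ˢ Set.Icc c d) ((volume : Measure ℝ).prod volume) :=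
    hh.continuousOn.integrableOn_compact (isCompact_Icc.prod isCompact_Icc)
  rw [Measure.volume_eq_prod, setIntegral_prod h hint, intervalIntegral.integral_of_le hab,
    ← integral_Icc_eq_integral_Ioc]
  refine setIntegral_congr_fun measurableSet_Icc fun x _ => ?_
  rw [intervalIntegral.integral_of_le hcd, ← integral_Icc_eq_integral_Ioc]

/-- Two period cells: for a continuous `1`-periodic `f : ℝ → ℝ`, `∫₀² f = 2 ∫₀¹ f`. [folklore] -/
theorem halfScaleTrace_intervalIntegral_two_of_periodic (f : ℝ → ℝ) (hf : Continuous f)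
    (hper : Function.Periodic f 1) :
    ∫ x in (0 : ℝ)..2, f x = 2 * ∫ x in (0 : ℝ)..1, f x := by
  have h1 : ∫ x in (1 : ℝ)..2, f x = ∫ x in (0 : ℝ)..1, f x := by
    have := hper.intervalIntegral_add_eq 1 0
    norm_num at this
    exact this
  rw [← intervalIntegral.integral_add_adjacent_intervals (hf.intervalIntegrable 0 1)
    (hf.intervalIntegrable 1 2), h1]
  ring

/-- Four period cells: for a continuous `h : ℝ × ℝ → ℝ` that is `1`-periodic in each variable,
`∫_{[0,2]²} h = 4 ∫_{[0,1]²} h` (iterated interval integrals; the inner integral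
`x ↦ ∫₀¹ h (x, y) dy` is continuous and `1`-periodic). [folklore] -/
theorem halfScaleTrace_setIntegral_twoSquare_of_periodic (h : ℝ × ℝ → ℝ) (hh : Continuous h)
    (hx : ∀ x y : ℝ, h (x + 1, y) = h (x, y)) (hy : ∀ x y : ℝ, h (x, y + 1) = h (x, y)) :
    (∫ q in Set.Icc (0 : ℝ) 2 ×ˢ Set.Icc (0 : ℝ) 2, h q) =
      4 * ∫ q in Set.Icc (0 : ℝ) 1 ×ˢ Set.Icc (0 : ℝ) 1, h q := by
  rw [halfScaleTrace_setIntegral_rect_eq_iterated h hh zero_le_two zero_le_two,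
    halfScaleTrace_setIntegral_rect_eq_iterated h hh zero_le_one zero_le_one]
  have inner : ∀ x : ℝ, ∫ y in (0 : ℝ)..2, h (x, y) = 2 * ∫ y in (0 : ℝ)..1, h (x, y) := fun x =>
    halfScaleTrace_intervalIntegral_two_of_periodic (fun y => h (x, y)) (by fun_prop) fun y => hy x y
  simp_rw [inner]
  have hF : Continuous fun x : ℝ => ∫ y in (0 : ℝ)..1, h (x, y) :=
    intervalIntegral.continuous_parametric_intervalIntegral_of_continuous'
      (f := fun x y => h (x, y)) (by simpa [Function.uncurry_def] using hh) 0 1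
  have hFper : Function.Periodic (fun x : ℝ => ∫ y in (0 : ℝ)..1, h (x, y)) 1 := by
    intro x
    simp only [hx]
  rw [intervalIntegral.integral_const_mul,
    halfScaleTrace_intervalIntegral_two_of_periodic _ hF hFper]
  ring

/-- **Half-scale trace** (tool stub of line `bernoulli-surface-topology`).  For a continuous scalar
function `g` on `ℝ³`, `1`-periodic in `x` and in `y`, the integral over the unit square of its
half-scale bottom trace `q ↦ g (2 • (q₁, q₂, 1)) = g (2q₁, 2q₂, 2)` equals its integral over the unit
square at height `2`: the planar change of variables `q ↦ 2 • q` gives `4⁻¹ ∫_{[0,2]²} g (·, ·, 2)`, and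
`[0,2]²` consists of four period cells of the continuous doubly `1`-periodic integrand. [folklore] -/
theorem stub_halfScaleTrace :
    ∀ (g : EuclideanSpace ℝ (Fin 3) → ℝ), Continuous g →
      (∀ X : EuclideanSpace ℝ (Fin 3),
        g (X + EuclideanSpace.single 0 (1 : ℝ)) = g X ∧ g (X + EuclideanSpace.single 1 (1 : ℝ)) = g X) →
      (∫ q in Set.Icc (0 : ℝ) 1 ×ˢ Set.Icc (0 : ℝ) 1, g ((2 : ℝ) • !₂[q.1, q.2, (1 : ℝ)])) =
        ∫ q in Set.Icc (0 : ℝ) 1 ×ˢ Set.Icc (0 : ℝ) 1, g !₂[q.1, q.2, (2 : ℝ)] := by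
  intro g hg hper
  -- the height-`2` slice of `g` as a function on the plane
  set h : ℝ × ℝ → ℝ := fun p => g !₂[p.1, p.2, (2 : ℝ)] with hh_def
  have hh : Continuous h := by
    rw [hh_def]
    fun_prop
  have h1 : ∀ q : ℝ × ℝ, g ((2 : ℝ) • !₂[q.1, q.2, (1 : ℝ)]) = h ((2 : ℝ) • q) := by
    intro q
    simp only [hh_def, Prod.smul_fst, Prod.smul_snd, smul_eq_mul]
    congr 1
    ext i
    fin_cases i <;> simp
  have hx : ∀ x y : ℝ, h (x + 1, y) = h (x, y) := by
    intro x y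
    have e : (!₂[x + 1, y, (2 : ℝ)] : EuclideanSpace ℝ (Fin 3)) =
        !₂[x, y, (2 : ℝ)] + EuclideanSpace.single 0 (1 : ℝ) := by
      ext i
      fin_cases i <;> simp
    simp only [hh_def]
    rw [e, (hper _).1]
  have hy : ∀ x y : ℝ, h (x, y + 1) = h (x, y) := by
    intro x y
    have e : (!₂[x, y + 1, (2 : ℝ)] : EuclideanSpace ℝ (Fin 3)) =
        !₂[x, y, (2 : ℝ)] + EuclideanSpace.single 1 (1 : ℝ) := by
      ext i
      fin_cases i <;> simp
    simp only [hh_def]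
    rw [e, (hper _).2]
  simp_rw [h1]
  rw [halfScaleTrace_setIntegral_unitSquare_comp_two_smul h,
    halfScaleTrace_setIntegral_twoSquare_of_periodic h hh hx hy]
  ring

end Summit.AnomalousDissipation.AnomalousDissipation.Theorems.HalfSpaceHierarchy
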